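import Literature.MathematicalPhysics.QuantumFieldTheory.Balaban1983to89.B15Claim189FlowAtRecord

/-!
# `Balaban1983to89.B15LeafKnitMassSel` — YM-DAG node N12 · [Balaban1989LargeFieldI] CMP **122** (1989) 175–202, (0.2)–(0.6) p. 176: THE MASS PROVISO OF THE
# [IV] LEAF AT NODE 00's BUNDLE READ AS PRINT STATES IT — *«the densities are positive, … the integration domains of the small field terms are nonempty, hence
# the denominators are positive»* (p. 176 ll. 14–16) — i.e. POSITIVE MASS OF THE DENOMINATOR TERMS `t_{s″}`, `s″ = ppSel s` (the IMAGE of the selector), plus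
# ONE FIBRE WITNESS per occurring denominator, INSTEAD OF positive mass of EVERY term of the (2.18) index

statement-level bookkeeping over published theorems with citation tags; kernel-checked compositions of tree theorems; nothing here is a claim about the Yang–Mills
mass gap.

CITATION HEADER (lean-in-tree rule).  Source: [Balaban1989LargeFieldI] («[IV]») (0.2)–(0.6) p. 176, p. 176 ll. 14–16 (verbatim above); record dictionaries
[Balaban1988Convergent] (2.18) p. 257, (3.25) p. 270.  Seat `pub-ymgap-dag-n12-e` (YM-PLAN Track A, HUMAN RULING D-0062; director-ym R134 row N12 s3 = ALTERNATIVE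
CURRENCY), generation 2, module 6 of the lineage.  BY NAME and UNCHANGED: n12-a's `B15LeafKnit` (`knitRData`, `KnitData`, `knitW15`, `expForm06_of_hyp05_image`,
`i180_knit_iff`), `B15LeafKnitExp` (`KnitData.logExp`), `B15LeafKnitRepr` (`knitOfRepr`, `WOfRepr`), `B15LeafKnitMass` (`normalization04_knit_of_mass` — which ALREADY
asks the mass at the denominators only —, `b15Leaf_knit_logExp_of_mass`, `normalization1102_of_rPrime_eq_rop_supp`), `B15LeafKnitTower9` (`sum_rterm_repTOfRecord9`),
r12's `B15Eq06Resum` (`quot03`, `quotSum`), `B15Norm1102Object.integral_fibreIntegral`, node00-def g30's `Node00.CarriersW` (`ResidW`, `WOfRecord₁₀`), def-T's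
`Node00.Record10` (`Provisos₁₀`), module 1 `B15RPrime1100OfRep` (`rPrimeDataOfSel`, `normalization1102_trhoOfRecord9_rPrimeDataOfSel`), module 2 `B15RPrime1100AtRecord`
(`terms_of_provisos₁₀`, `normalization1102_trhoOfRecord9_of_provisos₁₀`, `ResidW.pinRPrime`).

WHY THIS FILE.  The display `Node00.WDisplays₁₀.hmass : ∀ s, 0 < ∫dV t_s` (every pre-𝐑 term of `𝐓ρ_k` of record has positive mass) is what n12-a's mass-form knit
(`b15Leaf_WOfTower9_of_mass`) consumes; but the knit USES mass at two places only: (0.4) at the DENOMINATOR pieces `t_{ppSel s}` (`normalization04_knit_of_mass` takes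
`∀ Z, 0 < ∫ piece (pp Z)`), and (0.6) through `quotSum W > 0` at the OCCURRING regions `W ∈ image ppSel`.  The (2.18) index of record `SeqOfRecord` is EVERY
(2.1)-chain and the 𝐓-weights carry the residual `ζ` with no positivity law, so «every term has positive mass» is not evidently a theorem of a faithful record,
whereas print's proviso speaks of the OCCURRING small-field terms (the denominators).  This module re-cuts the knit on exactly that: `hmassSel : ∀ s, 0 < ∫dV t_{ppSel s}`
and `hfib : ∀ s, ∃ s′, ppSel s′ = ppSel s ∧ 0 < ∫dV t_{s′}` (each denominator is selected by SOME positive-mass term; immediate from `hmassSel` when the selector is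
idempotent — print's `Z″` has no passing components left, so `(Z″)″ = Z″` —, and from the old `∀ s` display with `s′ := s`).

WHAT THIS FILE PROVES (theorems only; 0 `def`, 0 `sorry`, 0 `instance`, 0 `notation`).
§1 generic knit level: `quot03_knit_nonneg`, `quot03_knit_pos_of_masses`, **`quotSum_knit_pos_of_massSel`** ((0.5)-sum of an occurring region positive from the
   denominator mass + a fibre witness), `fibreWitness_of_mass` ∕ `fibreWitness_of_idem` (the two sources of `hfib`), `hyp05Image_logExp_of_massSel`,
   **`b15Leaf_knit_logExp_of_massSel`** (n12-a's `b15Leaf_knit_logExp_of_mass` with `hmass` replaced by `hmassSel ∧ hfib`).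
§2 at a representation: `b15Leaf_WOfRepr_of_massSel`, `b15Leaf_WOfRepr_of_rPrime_massSel` ((1.102) by the identification, support form).
§3 at def-T's tower: **`b15Leaf_WOfTower9_of_massSel`**.
§4 at NODE 00's bundle of record `WOfRecord₁₀ θ λ P`: **`b15Leaf_WOfRecord₁₀_of_massSel`** (`Provisos₁₀` + `kSel P < P.K` + the (1.100) pin equation + `hmassSel` + `hfib`
   + Proposition 1 (1.78) + (1.80) + (1.89) ⇒ the [IV] leaf; `hm ∕ h0 ∕ hC ∕ h1102` from the record), `b15Leaf_WOfRecord₁₀_of_massSel_supp` (any run: the support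
   provisos of the knit datum displayed instead of `Provisos₁₀ + kSel < K`), `b15Leaf_WOfRecord₁₀_pinRPrime_of_massSel` (at the pinned layer, pin by `rfl`),
   `massSel_of_wDisplays₁₀` (A2: the old `∀ s` mass display `WDisplays₁₀.hmass` implies the new pair).

HONEST FRAMING.  Count-neutral: a weaker (print-faithful) mass proviso for the same knit; `hmassSel ∕ hfib` remain DISPLAYED (positivity of the occurring
denominators = [IV] p. 176's claim at the objects of record — positivity of `𝐓_k e^{A_k}` and non-emptiness of the constraint sets); nothing of Bałaban's asserted;
N12 NOT discharged; one finite four-torus programme at fixed `ε`, Bałaban AS PRINTED with locators; nothing continuum ∕ ℝ⁴ ∕ OS ∕ mass gap ∕ Clay.  No `sorry`, no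
`axiom`, no `instance`, no `notation`.
-/

noncomputable section

open scoped BigOperators
open MeasureTheory

namespace Literature.MathematicalPhysics.QuantumFieldTheory.Balaban1983to89

namespace B15LeafKnitMassSel

open DagBinding T4Continuum Node00
open B15 (Rop Normalization04 ExpForm06 Prop1Printed Ineq180)
open B15.BasicStep (fibreIntegral Claim189 RopReal)
open B15Eq06Resum (quot03 quotSum)
open B15Sect1Statements (RPrimeData Normalization1102 rPrime1100)
open B15Claim189Assembly (Setting189 new189 chiPP dom)
open B8Eq17ClassAkV1 (plaqsOf)
open B15Norm1102Object (integral_fibreIntegral)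
open B15LeafKnit (knitRData KnitData knitW15)
open B15LeafKnitRepr (knitOfRepr WOfRepr)
open B15LeafKnitMass (normalization04_knit_of_mass normalization1102_of_rPrime_eq_rop_supp)
open B15LeafKnitTower9 (sum_rterm_repTOfRecord9)
open B15RPrime1100OfRep (rPrimeDataOfSel normalization1102_trhoOfRecord9_rPrimeDataOfSel)
open B15RPrime1100AtRecord (terms_of_provisos₁₀ normalization1102_trhoOfRecord9_of_provisos₁₀)

/-! ## §1. The (0.5)-sums on the denominator-mass proviso -/

section Generic

variable {P : Params} {k : ℕ} {G : Type} [GaugeGroup G] [MeasurableSpace G] [HaarData G] [DecidableEq (PBond P k)]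
variable {R : Type} [Fintype R]

/-- The (0.3)-quotient `∫dV⌈_{Z′}ρ(Z,·) ∕ ∫dV⌈_{Z′}ρ(Z″,·)` of the knit datum is NONNEGATIVE for nonnegative, measurable, bounded pieces (a ratio of nonnegative
numbers; Lean's `x ∕ 0 = 0`). [cite: Balaban1989LargeFieldI, (0.3) p.176 (bookkeeping)] -/
theorem quot03_knit_nonneg (piece : R → Density P k G) (pp : R → R) (fib : R → Finset (PBond P k))
    (hm : ∀ Z, Measurable (piece Z)) (h0 : ∀ Z V, 0 ≤ piece Z V) {C : ℝ} (hC : ∀ Z V, piece Z V ≤ C) (Z : R) :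
    0 ≤ quot03 (knitRData piece pp fib) Z := by
  show 0 ≤ (∫ V, fibreIntegral (fib Z) (piece Z) V ∂(fieldMeasure P k G)) / ∫ V, fibreIntegral (fib Z) (piece (pp Z)) V ∂(fieldMeasure P k G)
  rw [integral_fibreIntegral (fib Z) (hm Z) (h0 Z) (hC Z), integral_fibreIntegral (fib Z) (hm _) (h0 _) (hC _)]
  exact div_nonneg (integral_nonneg (h0 Z)) (integral_nonneg (h0 _))

/-- … and POSITIVE when the piece `Z` and its denominator piece `Z″ = pp Z` both have positive mass. [cite: Balaban1989LargeFieldI, (0.3) p.176, p.176 ll.14–16] -/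
theorem quot03_knit_pos_of_masses (piece : R → Density P k G) (pp : R → R) (fib : R → Finset (PBond P k))
    (hm : ∀ Z, Measurable (piece Z)) (h0 : ∀ Z V, 0 ≤ piece Z V) {C : ℝ} (hC : ∀ Z V, piece Z V ≤ C) {Z : R}
    (hZ : 0 < ∫ V, piece Z V ∂(fieldMeasure P k G)) (hppZ : 0 < ∫ V, piece (pp Z) V ∂(fieldMeasure P k G)) :
    0 < quot03 (knitRData piece pp fib) Z := by
  show 0 < (∫ V, fibreIntegral (fib Z) (piece Z) V ∂(fieldMeasure P k G)) / ∫ V, fibreIntegral (fib Z) (piece (pp Z)) V ∂(fieldMeasure P k G)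
  rw [integral_fibreIntegral (fib Z) (hm Z) (h0 Z) (hC Z), integral_fibreIntegral (fib Z) (hm _) (h0 _) (hC _)]
  exact div_pos hZ hppZ

open Classical in
/-- **THE (0.5)-SUM OF AN OCCURRING REGION IS POSITIVE ON THE DENOMINATOR-MASS PROVISO**: if every denominator piece `ρ(Z″,·)`, `Z″ = pp Z`, has positive mass
and the occurring region `W` is selected by SOME positive-mass piece (`pp Z₀ = W`, `0 < ∫dV ρ(Z₀,·)`), then `quotSum W > 0` (a sum of nonnegative quotients with one
positive).  Replaces n12-a's `quotSum_knit_pos_of_mass` (mass of EVERY piece). [cite: Balaban1989LargeFieldI, (0.5) p.176, p.176 ll.14–16] -/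
theorem quotSum_knit_pos_of_massSel (piece : R → Density P k G) (pp : R → R) (fib : R → Finset (PBond P k))
    (hm : ∀ Z, Measurable (piece Z)) (h0 : ∀ Z V, 0 ≤ piece Z V) {C : ℝ} (hC : ∀ Z V, piece Z V ≤ C)
    (hmassSel : ∀ Z, 0 < ∫ V, piece (pp Z) V ∂(fieldMeasure P k G))
    {W : R} (hW : ∃ Z, pp Z = W ∧ 0 < ∫ V, piece Z V ∂(fieldMeasure P k G)) :
    0 < quotSum (knitRData piece pp fib) W := by
  obtain ⟨Z₀, hZ₀, hm₀⟩ := hW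
  unfold quotSum
  refine Finset.sum_pos' (fun Z _ => quot03_knit_nonneg piece pp fib hm h0 hC Z) ⟨Z₀, ?_, ?_⟩
  · exact Finset.mem_filter.2 ⟨Finset.mem_univ _, hZ₀⟩
  · exact quot03_knit_pos_of_masses piece pp fib hm h0 hC hm₀ (hmassSel Z₀)

omit [DecidableEq (PBond P k)] [Fintype R] in
/-- **Source 1 of the fibre witness: the old display.**  Positive mass of EVERY piece gives the witness with `Z′ := Z` (so every landed hypothesis list still
discharges the new one — A2). [cite: Balaban1989LargeFieldI, p.176 ll.14–16 (bookkeeping)] -/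
theorem fibreWitness_of_mass (piece : R → Density P k G) (pp : R → R)
    (hmass : ∀ Z, 0 < ∫ V, piece Z V ∂(fieldMeasure P k G)) :
    ∀ Z, ∃ Z', pp Z' = pp Z ∧ 0 < ∫ V, piece Z' V ∂(fieldMeasure P k G) := fun Z => ⟨Z, rfl, hmass Z⟩

omit [DecidableEq (PBond P k)] [Fintype R] in
/-- **Source 2 of the fibre witness: an IDEMPOTENT selector** (print's `Z″`: the passing components of `Z″` are gone, so `(Z″)″ = Z″`): with `pp (pp Z) = pp Z` the
denominator piece itself is the witness. [cite: Balaban1989LargeFieldI, (0.3) p.176, p.177 (the selection of Z″)] -/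
theorem fibreWitness_of_idem (piece : R → Density P k G) (pp : R → R) (hidem : ∀ Z, pp (pp Z) = pp Z)
    (hmassSel : ∀ Z, 0 < ∫ V, piece (pp Z) V ∂(fieldMeasure P k G)) :
    ∀ Z, ∃ Z', pp Z' = pp Z ∧ 0 < ∫ V, piece Z' V ∂(fieldMeasure P k G) := fun Z => ⟨pp Z, hidem Z, hmassSel Z⟩

variable [DecidableEq R] {P₀ : Params} {C ι : Type} (κ : KnitData P k G R P₀ C ι)

/-- **(0.5) on the occurring regions HOLDS for the `log`-pinned exponents on the denominator-mass proviso** (`exp (log q) = q`, `q > 0` by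
`quotSum_knit_pos_of_massSel`). [cite: Balaban1989LargeFieldI, (0.5) p.176] -/
theorem hyp05Image_logExp_of_massSel (hm : ∀ Z, Measurable (κ.piece Z)) (h0 : ∀ Z V, 0 ≤ κ.piece Z V) {Cρ : ℝ}
    (hC : ∀ Z V, κ.piece Z V ≤ Cρ) (hmassSel : ∀ Z, 0 < ∫ V, κ.piece (κ.pp Z) V ∂(fieldMeasure P k G))
    (hfib : ∀ Z, ∃ Z', κ.pp Z' = κ.pp Z ∧ 0 < ∫ V, κ.piece Z' V ∂(fieldMeasure P k G)) :
    ∀ W ∈ Finset.univ.image κ.logExp.pp, quotSum κ.logExp.rdata W = Real.exp (κ.logExp.Rexp W) := by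
  intro W hW
  obtain ⟨Z, _, hZ⟩ := Finset.mem_image.1 hW
  obtain ⟨Z', hZ', hmZ'⟩ := hfib Z
  exact (Real.exp_log (quotSum_knit_pos_of_massSel κ.piece κ.pp κ.fib hm h0 hC hmassSel ⟨Z', hZ'.trans hZ, hmZ'⟩)).symm

/-- **THE B15 LEAF AT `knitW15 κ.logExp` ON THE DENOMINATOR-MASS PROVISO**: n12-a's `b15Leaf_knit_logExp_of_mass` with `hmass : ∀ Z, 0 < ∫dV ρ(Z,·)` replaced by
`hmassSel : ∀ Z, 0 < ∫dV ρ(Z″,·)` + the fibre witness `hfib`; (0.4) by `normalization04_knit_of_mass` (which reads the denominators only), (0.6) by §1;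
DISPLAYED exactly Proposition 1 (1.78), (1.80) on the ℍ-domains, (1.89), (1.102). [cite: Balaban1989LargeFieldI, (0.4)–(0.6) p.176, Prop. 1 (1.78) p.194, (1.80) p.195, (1.89) p.198, (1.102) p.201] -/
theorem b15Leaf_knit_logExp_of_massSel (hm : ∀ Z, Measurable (κ.piece Z)) (h0 : ∀ Z V, 0 ≤ κ.piece Z V) {Cρ : ℝ}
    (hC : ∀ Z V, κ.piece Z V ≤ Cρ) (hmassSel : ∀ Z, 0 < ∫ V, κ.piece (κ.pp Z) V ∂(fieldMeasure P k G))
    (hfib : ∀ Z, ∃ Z', κ.pp Z' = κ.pp Z ∧ 0 < ∫ V, κ.piece Z' V ∂(fieldMeasure P k G))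
    (hP1 : Prop1Printed κ.LF)
    (h180 : ∀ U, new189 κ.D189 U → ∀ i, κ.D189.h ≤ i → i ≤ κ.D189.k → ∀ p ∈ plaqsOf (dom κ.D189 i),
      Ineq180 (κ.D189.dev0 U p) (κ.D189.ε κ.D189.k) κ.D189.η κ.D189.B₃ κ.D189.B₅ κ.D189.M κ.D189.δ (κ.D189.dist p) κ.D189.O1)
    (h189 : Claim189 (new189 κ.D189) (chiPP κ.D189)) (h1102 : Normalization1102 κ.D1100 κ.ρk) :
    B15Leaf (knitW15 κ.logExp) where
  n04 := normalization04_knit_of_mass κ.piece κ.pp κ.fib hm h0 hC hmassSel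
  e06 := B15LeafKnit.expForm06_of_hyp05_image κ.logExp.rdata κ.logExp.Rexp (hyp05Image_logExp_of_massSel κ hm h0 hC hmassSel hfib)
  p1 := hP1
  i180 := (B15LeafKnit.i180_knit_iff κ.logExp).2 h180
  c189 := h189
  e1102 := h1102

end Generic

/-! ## §2. At a (2.18) representation `r` with selector `sel` and fibre bonds `fib` -/

section Repr

variable {P : Params} {G : Type} [GaugeGroup G] [MeasurableSpace G] [HaarData G]
variable {j : ℕ} [DecidableEq (PBond P j)] {P₀ : Params} {C ι : Type}
  (r : Step.Repr218 P G j) (sel : r.Adm → r.Adm) (fib : r.Adm → Finset (PBond P j))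
  (LF : B15.LFVar) (D189 : Setting189 P₀ G C ι) (D1100 : RPrimeData P j G)

/-- **THE B15 LEAF AT THE PIN `WOfRepr r sel fib LF D189 D1100` ON THE DENOMINATOR-MASS PROVISO**: the terms `t_a` measurable ∕ nonnegative ∕ bounded, the
DENOMINATOR terms `t_{sel a}` of positive mass, a fibre witness per denominator, and EXACTLY Proposition 1 (1.78), (1.80), (1.89), (1.102) at `ρ = Σ_a t_a`.
n12-a's `b15Leaf_WOfRepr_of_mass` with the weaker mass clause. [cite: Balaban1989LargeFieldI, (0.2)–(0.6) p.176, p.176 ll.14–16, Prop. 1 (1.78) p.194, (1.80) p.195, (1.89) p.198, (1.102) p.201] -/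
theorem b15Leaf_WOfRepr_of_massSel (hm : ∀ a, Measurable (rterm r a)) (h0 : ∀ a V, 0 ≤ rterm r a V) {Cρ : ℝ}
    (hC : ∀ a V, rterm r a V ≤ Cρ) (hmassSel : ∀ a, 0 < ∫ V, rterm r (sel a) V ∂(fieldMeasure P j G))
    (hfib : ∀ a, ∃ a', sel a' = sel a ∧ 0 < ∫ V, rterm r a' V ∂(fieldMeasure P j G)) (hP1 : Prop1Printed LF)
    (h180 : ∀ U, new189 D189 U → ∀ i, D189.h ≤ i → i ≤ D189.k → ∀ p ∈ plaqsOf (dom D189 i),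
      Ineq180 (D189.dev0 U p) (D189.ε D189.k) D189.η D189.B₃ D189.B₅ D189.M D189.δ (D189.dist p) D189.O1)
    (h189 : Claim189 (new189 D189) (chiPP D189)) (h1102 : Normalization1102 D1100 (fun V => ∑ a, rterm r a V)) :
    B15Leaf (WOfRepr r sel fib LF D189 D1100) := by
  letI := Classical.decEq r.Adm
  exact b15Leaf_knit_logExp_of_massSel (knitOfRepr r sel fib LF D189 D1100) hm h0 hC hmassSel hfib hP1 h180 h189 h1102

/-- **The same with (1.102) DISCHARGED by the identification `rPrime1100 D1100 = RopReal (rterm r) sel fib` in SUPPORT form** (n12-a's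
`normalization1102_of_rPrime_eq_rop_supp` fed by n10-b's support provisos of the knit datum). [cite: Balaban1989LargeFieldI, (1.100)–(1.102) p.201, (0.4) p.176] -/
theorem b15Leaf_WOfRepr_of_rPrime_massSel (hm : ∀ a, Measurable (rterm r a)) (h0 : ∀ a V, 0 ≤ rterm r a V) {Cρ : ℝ}
    (hC : ∀ a V, rterm r a V ≤ Cρ) (hmassSel : ∀ a, 0 < ∫ V, rterm r (sel a) V ∂(fieldMeasure P j G))
    (hfib : ∀ a, ∃ a', sel a' = sel a ∧ 0 < ∫ V, rterm r a' V ∂(fieldMeasure P j G))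
    (hsupp : (repDataOfSel r sel fib).ProvisosSupp) (hP1 : Prop1Printed LF)
    (h180 : ∀ U, new189 D189 U → ∀ i, D189.h ≤ i → i ≤ D189.k → ∀ p ∈ plaqsOf (dom D189 i),
      Ineq180 (D189.dev0 U p) (D189.ε D189.k) D189.η D189.B₃ D189.B₅ D189.M D189.δ (D189.dist p) D189.O1)
    (h189 : Claim189 (new189 D189) (chiPP D189)) (h1100 : rPrime1100 D1100 = RopReal (rterm r) sel fib) :
    B15Leaf (WOfRepr r sel fib LF D189 D1100) :=
  b15Leaf_WOfRepr_of_massSel r sel fib LF D189 D1100 hm h0 hC hmassSel hfib hP1 h180 h189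
    (normalization1102_of_rPrime_eq_rop_supp r sel fib D1100 h1100 hsupp)

end Repr

/-! ## §3. At def-T's represented tower of record (`Tstep rep_k`, selector `ppSel p g (k+1)`, fibre bonds `fibOfSeq … (k+1)`) -/

section Tower

variable {F : T4Family} {N : ℕ} [NeZero N]
  (ν : Stage7Numerics) (τ : TowerNumerics) (E : B12.RunParams → ℝ) (w : StepWeightsOfRecord F N ν τ.M)
  (ppSel : PpSelOfRecord F ν τ.M) (p : B12.RunParams) (g : ℕ → ℝ) (k : ℕ) [DecidableEq (PBond (F.P p.K) (k + 1))]
  {P₀ : Params} {C ι : Type} (LF : B15.LFVar) (D189 : Setting189 P₀ (SU N) C ι) (D1100 : RPrimeData (F.P p.K) (k + 1) (SU N))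

/-- **THE B15 LEAF AT THE TOWER PIN ON THE DENOMINATOR-MASS PROVISO**: n12-a's `b15Leaf_WOfTower9_of_mass` with `hmass : ∀ s, 0 < ∫dV t_s` replaced by positive
mass of the DENOMINATOR terms `t_{ppSel s}` + a fibre witness per denominator. [cite: Balaban1989LargeFieldI, (0.2)–(0.6) p.176, p.176 ll.14–16, Prop. 1 (1.78) p.194, (1.80) p.195, (1.89) p.198, (1.102) p.201; Balaban1988Convergent, (3.25) p.270] -/
theorem b15Leaf_WOfTower9_of_massSel (hm : ∀ s, Measurable (rterm (repTOfRecord9 F N ν τ E w ppSel p g k) s))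
    (h0 : ∀ s V, 0 ≤ rterm (repTOfRecord9 F N ν τ E w ppSel p g k) s V) {Cρ : ℝ}
    (hC : ∀ s V, rterm (repTOfRecord9 F N ν τ E w ppSel p g k) s V ≤ Cρ)
    (hmassSel : ∀ s, 0 < ∫ V, rterm (repTOfRecord9 F N ν τ E w ppSel p g k) (ppSel p g (k + 1) s) V ∂(fieldMeasure (F.P p.K) (k + 1) (SU N)))
    (hfib : ∀ s, ∃ s', ppSel p g (k + 1) s' = ppSel p g (k + 1) s ∧
      0 < ∫ V, rterm (repTOfRecord9 F N ν τ E w ppSel p g k) s' V ∂(fieldMeasure (F.P p.K) (k + 1) (SU N)))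
    (hP1 : Prop1Printed LF)
    (h180 : ∀ U, new189 D189 U → ∀ i, D189.h ≤ i → i ≤ D189.k → ∀ q ∈ plaqsOf (dom D189 i),
      Ineq180 (D189.dev0 U q) (D189.ε D189.k) D189.η D189.B₃ D189.B₅ D189.M D189.δ (D189.dist q) D189.O1)
    (h189 : Claim189 (new189 D189) (chiPP D189))
    (h1102 : Normalization1102 D1100 (trhoOfRecord9 F N ν τ E w ppSel p g k)) :
    B15Leaf (WOfRepr (repTOfRecord9 F N ν τ E w ppSel p g k) (ppSel p g (k + 1)) (fibOfSeq F ν τ p g (k + 1)) LF D189 D1100) :=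
  b15Leaf_WOfRepr_of_massSel _ _ _ LF D189 D1100 hm h0 hC hmassSel hfib hP1 h180 h189 (by rw [sum_rterm_repTOfRecord9]; exact h1102)

end Tower

/-! ## §4. At NODE 00's bundle of record `WOfRecord₁₀ θ λ P` (Stage 10 keys; the ₁₂ records read `θ.toStage9Params`) -/

section Record

variable {F : T4Family} {N : ℕ} [NeZero N] {θ : Stage9Params F N} {lam : ResidW F N}

/-- **THE [IV] LEAF AT THE BUNDLE OF RECORD ON THE DENOMINATOR-MASS PROVISO** — node00-def g30's `b15Leaf_WOfRecord₁₀_of_displays` with the display structure's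
`hmass : ∀ s, 0 < ∫dV t_s` REPLACED by positive mass of the denominators `t_{ppSel s}` + a fibre witness, and `hm ∕ h0 ∕ hC ∕ h1102` READ OFF THE RECORD
(`Provisos₁₀.rstep` through modules 1–2) given `kSel P < P.K` and the (1.100) pin equation: the leaf costs `hmassSel`, `hfib` and EXACTLY Proposition 1 (1.78),
(1.80), (1.89). [cite: Balaban1989LargeFieldI, (0.2)–(0.6) p.176, p.176 ll.14–16, Prop. 1 (1.78) p.194, (1.80) p.195, (1.89) p.198, (1.99)–(1.102) pp.200–201] -/
theorem b15Leaf_WOfRecord₁₀_of_massSel (hP : θ.Provisos₁₀) {P : B12.RunParams} (hk : lam.kSel P < P.K)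
    (hpin : lam.D1100 P
      = rPrimeDataOfSel (repTOfRecord9 F N θ.ν θ.τ9 (EOfRecord₁₀ F N θ) (wOfRecord₉ F N θ) θ.ppSel P (gOfRecord₁₀ F N θ P) (lam.kSel P))
          (θ.ppSel P (gOfRecord₁₀ F N θ P) (lam.kSel P + 1)) (fibOfSeq F θ.ν θ.τ9 P (gOfRecord₁₀ F N θ P) (lam.kSel P + 1)))
    (hmassSel : ∀ s, 0 < ∫ V, rterm (repTOfRecord9 F N θ.ν θ.τ9 (EOfRecord₁₀ F N θ) (wOfRecord₉ F N θ) θ.ppSel P (gOfRecord₁₀ F N θ P) (lam.kSel P))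
      (θ.ppSel P (gOfRecord₁₀ F N θ P) (lam.kSel P + 1) s) V ∂(fieldMeasure (F.P P.K) (lam.kSel P + 1) (SU N)))
    (hfib : ∀ s, ∃ s', θ.ppSel P (gOfRecord₁₀ F N θ P) (lam.kSel P + 1) s' = θ.ppSel P (gOfRecord₁₀ F N θ P) (lam.kSel P + 1) s ∧
      0 < ∫ V, rterm (repTOfRecord9 F N θ.ν θ.τ9 (EOfRecord₁₀ F N θ) (wOfRecord₉ F N θ) θ.ppSel P (gOfRecord₁₀ F N θ P) (lam.kSel P)) s' V
        ∂(fieldMeasure (F.P P.K) (lam.kSel P + 1) (SU N)))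
    (hP1 : Prop1Printed (lam.LF P))
    (h180 : ∀ U, new189 (lam.D189 P) U → ∀ i, (lam.D189 P).h ≤ i → i ≤ (lam.D189 P).k → ∀ q ∈ plaqsOf (dom (lam.D189 P) i),
      Ineq180 ((lam.D189 P).dev0 U q) ((lam.D189 P).ε (lam.D189 P).k) (lam.D189 P).η (lam.D189 P).B₃ (lam.D189 P).B₅ (lam.D189 P).M (lam.D189 P).δ
        ((lam.D189 P).dist q) (lam.D189 P).O1)
    (h189 : Claim189 (new189 (lam.D189 P)) (chiPP (lam.D189 P))) : B15Leaf (WOfRecord₁₀ F N θ lam P) := by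
  obtain ⟨hm, h0, hC⟩ := terms_of_provisos₁₀ θ hP P (lam.kSel P) hk
  obtain ⟨Cρ, hCρ⟩ := hC
  have h1102 : Normalization1102 (lam.D1100 P)
      (trhoOfRecord9 F N θ.ν θ.τ9 (EOfRecord₁₀ F N θ) (wOfRecord₉ F N θ) θ.ppSel P (gOfRecord₁₀ F N θ P) (lam.kSel P)) := by
    rw [hpin]
    exact normalization1102_trhoOfRecord9_of_provisos₁₀ θ hP P (lam.kSel P) hk
  exact b15Leaf_WOfTower9_of_massSel θ.ν θ.τ9 (EOfRecord₁₀ F N θ) (wOfRecord₉ F N θ) θ.ppSel P (gOfRecord₁₀ F N θ P) (lam.kSel P)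
    (lam.LF P) (lam.D189 P) (lam.D1100 P) hm h0 hCρ hmassSel hfib hP1 h180 h189 h1102

/-- **The same, ANY RUN, from the support provisos of the knit datum** (the degenerate-run form, cf. module 2 §5: below `K` the provisos are the record's `rstep`,
otherwise displayed): `hm ∕ h0 ∕ hC ∕ h1102` from `hsupp` through module 1. [cite: Balaban1989LargeFieldI, (0.2)–(0.6) p.176, Prop. 1 (1.78) p.194, (1.80) p.195, (1.89) p.198, (1.99)–(1.102) pp.200–201] -/
theorem b15Leaf_WOfRecord₁₀_of_massSel_supp {P : B12.RunParams}
    (hsupp : (repDataOfSel (repTOfRecord9 F N θ.ν θ.τ9 (EOfRecord₁₀ F N θ) (wOfRecord₉ F N θ) θ.ppSel P (gOfRecord₁₀ F N θ P) (lam.kSel P))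
      (θ.ppSel P (gOfRecord₁₀ F N θ P) (lam.kSel P + 1)) (fibOfSeq F θ.ν θ.τ9 P (gOfRecord₁₀ F N θ P) (lam.kSel P + 1))).ProvisosSupp)
    (hpin : lam.D1100 P
      = rPrimeDataOfSel (repTOfRecord9 F N θ.ν θ.τ9 (EOfRecord₁₀ F N θ) (wOfRecord₉ F N θ) θ.ppSel P (gOfRecord₁₀ F N θ P) (lam.kSel P))
          (θ.ppSel P (gOfRecord₁₀ F N θ P) (lam.kSel P + 1)) (fibOfSeq F θ.ν θ.τ9 P (gOfRecord₁₀ F N θ P) (lam.kSel P + 1)))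
    (hmassSel : ∀ s, 0 < ∫ V, rterm (repTOfRecord9 F N θ.ν θ.τ9 (EOfRecord₁₀ F N θ) (wOfRecord₉ F N θ) θ.ppSel P (gOfRecord₁₀ F N θ P) (lam.kSel P))
      (θ.ppSel P (gOfRecord₁₀ F N θ P) (lam.kSel P + 1) s) V ∂(fieldMeasure (F.P P.K) (lam.kSel P + 1) (SU N)))
    (hfib : ∀ s, ∃ s', θ.ppSel P (gOfRecord₁₀ F N θ P) (lam.kSel P + 1) s' = θ.ppSel P (gOfRecord₁₀ F N θ P) (lam.kSel P + 1) s ∧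
      0 < ∫ V, rterm (repTOfRecord9 F N θ.ν θ.τ9 (EOfRecord₁₀ F N θ) (wOfRecord₉ F N θ) θ.ppSel P (gOfRecord₁₀ F N θ P) (lam.kSel P)) s' V
        ∂(fieldMeasure (F.P P.K) (lam.kSel P + 1) (SU N)))
    (hP1 : Prop1Printed (lam.LF P))
    (h180 : ∀ U, new189 (lam.D189 P) U → ∀ i, (lam.D189 P).h ≤ i → i ≤ (lam.D189 P).k → ∀ q ∈ plaqsOf (dom (lam.D189 P) i),
      Ineq180 ((lam.D189 P).dev0 U q) ((lam.D189 P).ε (lam.D189 P).k) (lam.D189 P).η (lam.D189 P).B₃ (lam.D189 P).B₅ (lam.D189 P).M (lam.D189 P).δ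
        ((lam.D189 P).dist q) (lam.D189 P).O1)
    (h189 : Claim189 (new189 (lam.D189 P)) (chiPP (lam.D189 P))) : B15Leaf (WOfRecord₁₀ F N θ lam P) := by
  classical
  obtain ⟨hm, h0, ⟨Cρ, hCρ⟩, -⟩ := id hsupp
  have h1102 : Normalization1102 (lam.D1100 P)
      (trhoOfRecord9 F N θ.ν θ.τ9 (EOfRecord₁₀ F N θ) (wOfRecord₉ F N θ) θ.ppSel P (gOfRecord₁₀ F N θ P) (lam.kSel P)) := by
    rw [hpin]
    exact normalization1102_trhoOfRecord9_rPrimeDataOfSel θ.ν θ.τ9 (EOfRecord₁₀ F N θ) (wOfRecord₉ F N θ) θ.ppSel P (gOfRecord₁₀ F N θ P) (lam.kSel P) hsupp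
  exact b15Leaf_WOfTower9_of_massSel θ.ν θ.τ9 (EOfRecord₁₀ F N θ) (wOfRecord₉ F N θ) θ.ppSel P (gOfRecord₁₀ F N θ P) (lam.kSel P)
    (lam.LF P) (lam.D189 P) (lam.D1100 P) hm h0 hCρ hmassSel hfib hP1 h180 h189 h1102

/-- **The same AT THE PINNED LAYER `λ.pinRPrime θ`** (module 2's (1.100) pin; pin equation by `rfl`): `Provisos₁₀` + `kSel P < P.K` + `hmassSel` + `hfib` + Proposition 1
(1.78) + (1.80) + (1.89) ⇒ the [IV] leaf at the bundle of record. [cite: Balaban1989LargeFieldI, (0.2)–(0.6) p.176, p.176 ll.14–16, Prop. 1 (1.78) p.194, (1.80) p.195, (1.89) p.198, (1.99)–(1.102) pp.200–201] -/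
theorem b15Leaf_WOfRecord₁₀_pinRPrime_of_massSel (hP : θ.Provisos₁₀) {P : B12.RunParams} (hk : lam.kSel P < P.K)
    (hmassSel : ∀ s, 0 < ∫ V, rterm (repTOfRecord9 F N θ.ν θ.τ9 (EOfRecord₁₀ F N θ) (wOfRecord₉ F N θ) θ.ppSel P (gOfRecord₁₀ F N θ P) (lam.kSel P))
      (θ.ppSel P (gOfRecord₁₀ F N θ P) (lam.kSel P + 1) s) V ∂(fieldMeasure (F.P P.K) (lam.kSel P + 1) (SU N)))
    (hfib : ∀ s, ∃ s', θ.ppSel P (gOfRecord₁₀ F N θ P) (lam.kSel P + 1) s' = θ.ppSel P (gOfRecord₁₀ F N θ P) (lam.kSel P + 1) s ∧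
      0 < ∫ V, rterm (repTOfRecord9 F N θ.ν θ.τ9 (EOfRecord₁₀ F N θ) (wOfRecord₉ F N θ) θ.ppSel P (gOfRecord₁₀ F N θ P) (lam.kSel P)) s' V
        ∂(fieldMeasure (F.P P.K) (lam.kSel P + 1) (SU N)))
    (hP1 : Prop1Printed (lam.LF P))
    (h180 : ∀ U, new189 (lam.D189 P) U → ∀ i, (lam.D189 P).h ≤ i → i ≤ (lam.D189 P).k → ∀ q ∈ plaqsOf (dom (lam.D189 P) i),
      Ineq180 ((lam.D189 P).dev0 U q) ((lam.D189 P).ε (lam.D189 P).k) (lam.D189 P).η (lam.D189 P).B₃ (lam.D189 P).B₅ (lam.D189 P).M (lam.D189 P).δ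
        ((lam.D189 P).dist q) (lam.D189 P).O1)
    (h189 : Claim189 (new189 (lam.D189 P)) (chiPP (lam.D189 P))) : B15Leaf (WOfRecord₁₀ F N θ (lam.pinRPrime θ) P) :=
  b15Leaf_WOfRecord₁₀_of_massSel (lam := lam.pinRPrime θ) hP hk rfl hmassSel hfib hP1 h180 h189

/-- **A2 — the old display implies the new pair**: from `WDisplays₁₀.hmass : ∀ s, 0 < ∫dV t_s` both `hmassSel` (at `s := ppSel s`) and the fibre witness (`s′ := s`)
follow, so every closer over `WDisplays₁₀` factors through §4. [cite: Balaban1989LargeFieldI, p.176 ll.14–16 (bookkeeping)] -/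
theorem massSel_of_wDisplays₁₀ {P : B12.RunParams} (hd : WDisplays₁₀ θ lam P) :
    (∀ s, 0 < ∫ V, rterm (repTOfRecord9 F N θ.ν θ.τ9 (EOfRecord₁₀ F N θ) (wOfRecord₉ F N θ) θ.ppSel P (gOfRecord₁₀ F N θ P) (lam.kSel P))
      (θ.ppSel P (gOfRecord₁₀ F N θ P) (lam.kSel P + 1) s) V ∂(fieldMeasure (F.P P.K) (lam.kSel P + 1) (SU N))) ∧
    (∀ s, ∃ s', θ.ppSel P (gOfRecord₁₀ F N θ P) (lam.kSel P + 1) s' = θ.ppSel P (gOfRecord₁₀ F N θ P) (lam.kSel P + 1) s ∧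
      0 < ∫ V, rterm (repTOfRecord9 F N θ.ν θ.τ9 (EOfRecord₁₀ F N θ) (wOfRecord₉ F N θ) θ.ppSel P (gOfRecord₁₀ F N θ P) (lam.kSel P)) s' V
        ∂(fieldMeasure (F.P P.K) (lam.kSel P + 1) (SU N))) :=
  ⟨fun _ => hd.hmass _, fun s => ⟨s, rfl, hd.hmass s⟩⟩

end Record

end B15LeafKnitMassSel

end Literature.MathematicalPhysics.QuantumFieldTheory.Balaban1983to89

end
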